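import Mathlib.Topology.Homotopy.Lifting
import Mathlib.GroupTheory.Commutator.Basic
import HarnessLib

/-!
# Monodromy of a covering with an abelian, fibre-transitive group of deck transformations

Topic `Literature/Topology/CoveringSpaces` (general covering-space infrastructure; written for the
cell sub-node [AbsTopIII] Cor 2.7 (b).7 `AbelianCoverOfPuncturedTorusExtends`, "an abelian finite
étale covering [which necessarily extends to a covering of the one-point compactification]": the
topological input there is that the loop around the puncture, a commutator in `π₁`, has trivial
monodromy in any abelian Galois covering).

Let `p : E → X` be a covering map and `H` a group of deck transformations of `p` (homeomorphisms
`φ` of `E` with `p ∘ φ = p`) which is **abelian** and acts **transitively on the fibre** `p⁻¹{x}`.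
Then (Hatcher, *Algebraic Topology*, §1.3, "Deck Transformations and Group Actions", pp. 70–71:
for a normal covering the action of `π₁(X, x)` on the fibre factors through the deck group
`G(X̃) ≅ π₁(X, x)/p_*π₁(X̃)`; here read for an abelian `G`):

* `liftPath_deck`, `monodromy_deck` — deck transformations commute with path lifting and with
  Mathlib's monodromy `IsCoveringMap.monodromy` (uniqueness of lifts, Hatcher Prop. 1.34);
* `exists_deck_eq_monodromy` — the monodromy of every loop class `γ ∈ π₁(X, x)` on `p⁻¹{x}` IS the
  restriction of some `φ ∈ H` (an abelian transitive permutation group is regular, and its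
  centraliser is itself);
* `monodromy_comm` — hence any two monodromy permutations of the fibre commute;
* `commutator_le_ker_monodromyPerm` — **the commutator subgroup of `π₁(X, x)` acts trivially on
  `p⁻¹{x}`** (`IsCoveringMap.monodromyPerm`);
* `monodromy_eq_self_of_mem_commutator`, `liftPath_one_eq_of_mem_commutator` — consumable forms:
  a loop whose class lies in the commutator subgroup lifts to CLOSED loops from every point of the
  fibre.

Everything is proved; there are no definitions and no named facts.

## References

* A. Hatcher, *Algebraic Topology*, CUP (2002), §1.3, Prop. 1.34 (unique lifting), Prop. 1.39 and
  the paragraph "Deck Transformations and Group Actions" (pp. 70–71). [HatcherAT2002]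
-/

noncomputable section

open scoped unitInterval

namespace Literature.Topology.CoveringSpaces

namespace AbelianDeck

variable {E X : Type*} [TopologicalSpace E] [TopologicalSpace X] {p : E → X}

/-- **Deck transformations commute with path lifting** (uniqueness of lifts, Hatcher Prop. 1.34):
if `φ` is a homeomorphism of `E` over `X`, the lift of `γ` from `φ e` is `φ ∘` (the lift of `γ`
from `e`). [cite: HatcherAT2002, §1.3 Prop. 1.34] -/
theorem liftPath_deck (cov : IsCoveringMap p) (φ : E ≃ₜ E) (hφ : ∀ e, p (φ e) = p e)
    (γ : C(I, X)) (e : E) (he : γ 0 = p e) (t : I) :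
    cov.liftPath γ (φ e) (he.trans (hφ e).symm) t = φ (cov.liftPath γ e he t) := by
  have h : (fun t ↦ φ (cov.liftPath γ e he t)) = cov.liftPath γ (φ e) (he.trans (hφ e).symm) := by
    refine (cov.eq_liftPath_iff (he.trans (hφ e).symm)).2
      ⟨φ.continuous.comp (cov.liftPath γ e he).continuous, ?_, ?_⟩
    · funext s
      simp only [Function.comp_apply, hφ]
      exact congrFun (cov.liftPath_lifts γ e he) s
    · simp only [cov.liftPath_zero]
  exact (congrFun h t).symm

/-- **Deck transformations commute with monodromy**: for `φ` a homeomorphism of `E` over `X` and a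
homotopy class of paths `γ` from `x` to `y`, the monodromy of `γ` at `φ e` is `φ` of the monodromy
of `γ` at `e`. [cite: HatcherAT2002, §1.3 Prop. 1.34] -/
theorem monodromy_deck (cov : IsCoveringMap p) (φ : E ≃ₜ E) (hφ : ∀ e, p (φ e) = p e)
    {x y : X} (γ : Path.Homotopic.Quotient x y) (e : p ⁻¹' {x}) :
    (cov.monodromy γ ⟨φ e, by
        rw [Set.mem_preimage, hφ, Set.mem_singleton_iff]; exact e.2⟩ : E) =
      φ (cov.monodromy γ e) := by
  obtain ⟨c, rfl⟩ := Path.Homotopic.Quotient.mk_surjective γ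
  exact liftPath_deck cov φ hφ c e (c.source.trans e.2.symm) 1

variable {H : Subgroup (E ≃ₜ E)}

omit [TopologicalSpace X] in
/-- An abelian group of deck transformations acting transitively on a fibre acts FREELY on it:
if `ψ e₀ = e₀` for one point `e₀` of the fibre then `ψ` fixes the whole fibre (Hatcher: "only the
identity deck transformation can fix a point", here fibrewise and without path-connectedness).
[cite: HatcherAT2002, §1.3 p.70 (deck transformations; normal coverings)] -/
theorem deck_apply_eq_self_of_apply_eq_self (hcomm : ∀ φ ψ : H, φ * ψ = ψ * φ) {x : X}
    (htrans : ∀ e e' : E, p e = x → p e' = x → ∃ φ : H, (φ : E ≃ₜ E) e = e')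
    (ψ : H) {e₀ : E} (he₀ : p e₀ = x) (hfix : (ψ : E ≃ₜ E) e₀ = e₀) {e : E} (he : p e = x) :
    (ψ : E ≃ₜ E) e = e := by
  obtain ⟨φ, rfl⟩ := htrans e₀ e he₀ he
  have h := hcomm ψ φ
  have h' : ((ψ * φ : H) : E ≃ₜ E) e₀ = ((φ * ψ : H) : E ≃ₜ E) e₀ := by rw [h]
  simp only [Subgroup.coe_mul, Homeomorph.mul_apply] at h'
  rw [h', hfix]

/-- **The monodromy is given by a deck transformation.** For a covering map `p` and an abelian
group `H` of deck transformations acting transitively on `p⁻¹{x}`, the monodromy of every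
homotopy class of loops `γ` at `x` coincides on `p⁻¹{x}` with some `φ ∈ H`: pick `e₀` in the
fibre and `φ ∈ H` with `φ e₀ = γ · e₀`; for `e = ψ e₀`,
`γ · e = γ · (ψ e₀) = ψ (γ · e₀) = ψ (φ e₀) = φ (ψ e₀) = φ e`.
[cite: HatcherAT2002, §1.3 pp. 70–71 (action of `π₁` on the fibre of a normal covering via `G(X̃)`)] -/
theorem exists_deck_eq_monodromy (cov : IsCoveringMap p)
    (hdeck : ∀ φ : H, ∀ e, p ((φ : E ≃ₜ E) e) = p e) (hcomm : ∀ φ ψ : H, φ * ψ = ψ * φ)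
    {x : X} (htrans : ∀ e e' : E, p e = x → p e' = x → ∃ φ : H, (φ : E ≃ₜ E) e = e')
    (γ : Path.Homotopic.Quotient x x) :
    ∃ φ : H, ∀ e : p ⁻¹' {x}, (cov.monodromy γ e : E) = (φ : E ≃ₜ E) e := by
  by_cases hne : (p ⁻¹' {x}).Nonempty
  · obtain ⟨e₀, he₀⟩ := hne
    have he₀' : p e₀ = x := he₀
    obtain ⟨φ, hφ⟩ := htrans e₀ (cov.monodromy γ ⟨e₀, he₀⟩) he₀' (cov.monodromy γ ⟨e₀, he₀⟩).2
    refine ⟨φ, fun e ↦ ?_⟩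
    obtain ⟨ψ, hψ⟩ := htrans e₀ e he₀' e.2
    have h1 : (cov.monodromy γ e : E) =
        (cov.monodromy γ ⟨(ψ : E ≃ₜ E) e₀, by
          rw [Set.mem_preimage, hdeck, Set.mem_singleton_iff]; exact he₀'⟩ : E) := by
      congr 2
      exact Subtype.ext hψ.symm
    rw [h1, monodromy_deck cov (ψ : E ≃ₜ E) (hdeck ψ) γ ⟨e₀, he₀⟩, ← hφ, ← hψ]
    have h := hcomm ψ φ
    have h' : ((ψ * φ : H) : E ≃ₜ E) e₀ = ((φ * ψ : H) : E ≃ₜ E) e₀ := by rw [h]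
    simpa only [Subgroup.coe_mul, Homeomorph.mul_apply] using h'
  · refine ⟨1, fun e ↦ (hne ⟨e, e.2⟩).elim⟩

/-- **Monodromy permutations commute** when an abelian group of deck transformations acts
transitively on the fibre. [cite: HatcherAT2002, §1.3 pp. 70–71] -/
theorem monodromy_comm (cov : IsCoveringMap p)
    (hdeck : ∀ φ : H, ∀ e, p ((φ : E ≃ₜ E) e) = p e) (hcomm : ∀ φ ψ : H, φ * ψ = ψ * φ)
    {x : X} (htrans : ∀ e e' : E, p e = x → p e' = x → ∃ φ : H, (φ : E ≃ₜ E) e = e')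
    (γ γ' : Path.Homotopic.Quotient x x) (e : p ⁻¹' {x}) :
    cov.monodromy γ (cov.monodromy γ' e) = cov.monodromy γ' (cov.monodromy γ e) := by
  obtain ⟨φ, hφ⟩ := exists_deck_eq_monodromy cov hdeck hcomm htrans γ
  obtain ⟨φ', hφ'⟩ := exists_deck_eq_monodromy cov hdeck hcomm htrans γ'
  apply Subtype.ext
  rw [hφ, hφ', hφ', hφ]
  have h := hcomm φ φ'
  have h' : ((φ * φ' : H) : E ≃ₜ E) e = ((φ' * φ : H) : E ≃ₜ E) e := by rw [h]
  simpa only [Subgroup.coe_mul, Homeomorph.mul_apply] using h'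

/-- **The commutator subgroup of `π₁(X, x)` acts trivially on the fibre** of a covering map with
an abelian, fibre-transitive group of deck transformations: the monodromy representation
`π₁(X, x) → Perm(p⁻¹{x})` (Mathlib `IsCoveringMap.monodromyPerm`) has abelian image.
[cite: HatcherAT2002, §1.3 Prop. 1.39 and pp. 70–71] -/
theorem commutator_le_ker_monodromyPerm (cov : IsCoveringMap p)
    (hdeck : ∀ φ : H, ∀ e, p ((φ : E ≃ₜ E) e) = p e) (hcomm : ∀ φ ψ : H, φ * ψ = ψ * φ)
    {x : X} (htrans : ∀ e e' : E, p e = x → p e' = x → ∃ φ : H, (φ : E ≃ₜ E) e = e') :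
    commutator (FundamentalGroup X x) ≤ (cov.monodromyPerm x).ker := by
  rw [commutator_def, Subgroup.commutator_le]
  intro g₁ _ g₂ _
  rw [MonoidHom.mem_ker, map_commutatorElement, commutatorElement_eq_one_iff_commute]
  refine Equiv.ext fun e ↦ ?_
  simp only [Equiv.Perm.coe_mul, Function.comp_apply, IsCoveringMap.coe_monodromyPerm]
  exact monodromy_comm cov hdeck hcomm htrans g₁ g₂ e

/-- Consumable form: a loop class in the commutator subgroup has TRIVIAL monodromy on the fibre.
[cite: HatcherAT2002, §1.3 pp. 70–71] -/
theorem monodromy_eq_self_of_mem_commutator (cov : IsCoveringMap p)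
    (hdeck : ∀ φ : H, ∀ e, p ((φ : E ≃ₜ E) e) = p e) (hcomm : ∀ φ ψ : H, φ * ψ = ψ * φ)
    {x : X} (htrans : ∀ e e' : E, p e = x → p e' = x → ∃ φ : H, (φ : E ≃ₜ E) e = e')
    {γ : FundamentalGroup X x} (hγ : γ ∈ commutator (FundamentalGroup X x))
    (e : p ⁻¹' {x}) : cov.monodromy γ e = e := by
  have h := commutator_le_ker_monodromyPerm cov hdeck hcomm htrans hγ
  rw [MonoidHom.mem_ker] at h
  have h' : cov.monodromyPerm x γ e = (1 : Equiv.Perm (p ⁻¹' {x})) e := by rw [h]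
  rwa [IsCoveringMap.coe_monodromyPerm, Equiv.Perm.coe_one, id_eq] at h'

/-- Consumable form on paths: if the class of the loop `γ` at `x` lies in the commutator subgroup
of `π₁(X, x)`, then **the lift of `γ` from every point `e` over `x` is a closed loop**
(`liftPath γ e 1 = e`). [cite: HatcherAT2002, §1.3 pp. 70–71] -/
theorem liftPath_one_eq_of_mem_commutator (cov : IsCoveringMap p)
    (hdeck : ∀ φ : H, ∀ e, p ((φ : E ≃ₜ E) e) = p e) (hcomm : ∀ φ ψ : H, φ * ψ = ψ * φ)
    {x : X} (htrans : ∀ e e' : E, p e = x → p e' = x → ∃ φ : H, (φ : E ≃ₜ E) e = e')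
    (γ : Path x x)
    (hγ : FundamentalGroup.fromPath (Path.Homotopic.Quotient.mk γ) ∈
      commutator (FundamentalGroup X x))
    (e : E) (he : p e = x) :
    cov.liftPath γ e (γ.source.trans he.symm) 1 = e := by
  have h := monodromy_eq_self_of_mem_commutator cov hdeck hcomm htrans hγ ⟨e, he⟩
  exact congrArg Subtype.val h

end AbelianDeck

end Literature.Topology.CoveringSpaces

end
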